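/-
Copyright: seat `ym-line-cbag-p2` (prover-ym-line-cbag-p2-g0-0), route `ColdBoxAllGroups`, crux `BulkAllGroups`
(stmt-QuantumFields-22255), line `dlr-chessboard-G` (skeleton `Cruxes/BulkAllGroups/Lines/birth.lean`).
-/
import Summits.QuantumFields.YangMills.Theorems.WeakCouplingRatesColdBoxDirichletShiftedCov
import Summits.QuantumFields.YangMills.Theorems.ColdBoxAllGroupsBulkAllGroupsShiftedMeanD

/-!
# Crux `BulkAllGroups` (stmt-QuantumFields-22255), interfaces `KernelCovExpansionG` / `FlatCovExpansionG`: the Gaussian side of the kernel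
# COVARIANCE expansion with a datum for `D` colours — `D`-colour port of §3 of `WeakCouplingRatesColdBoxDirichletShiftedCov` (group-free)

With `f = ½Σ_{c<D} (F_c + X_p(t_c))²`, `g = ½Σ_{c<D} (G_c + X_q(t_c))²` under the `D`-fold product `D1'^{⊗D}` of the temporal-gauge Dirichlet
Gaussian (the sibling line's `gaussD H D`): `Cov(f, g) = (D/2)·C_D(p,q)² + (Σ_c F_cG_c)·C_D(p,q)` (`cov_quadObs_piD_eq`; colour additivity
`cov_sum_pi_eq_sum_cov` + the one-colour Wick identity `cov_const_add_sq`), with the datum form `cov_quadObs_datum_eqD` (the exact Gaussian value of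
`KernelCovExpansionG`) and the flat form `cov_quadObs_flat_eqD` (the value of `FlatCovExpansionG`).  The `SU(2)` file has `D = 3`, constant `3/2`.
Pure Gaussian bookkeeping; no group, no chart.  No new definition; standard axioms.  NOT a claim about the mass gap; the Yang–Mills mass gap is
NOT proved by any of this.
-/

set_option autoImplicit false

noncomputable section

open MeasureTheory ProbabilityTheory Finset Matrix Real
open Literature.Probability.LatticeModels
open Literature.MathematicalPhysics.QuantumLattice
open Literature.MathematicalPhysics.QuantumFieldTheory
open Literature.MathematicalPhysics.QuantumFieldTheory.LatticeMaxwell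
open Literature.MathematicalPhysics.QuantumFieldTheory.AxialGauge
open Summit.QuantumFields.YangMills.Theorems.WeakCouplingRates

namespace Summit.QuantumFields.YangMills.Theorems.ColdBoxAllGroups

variable {H D : ℕ}

/-- **`D` colours, exact covariance**: with `f = ½Σ_c (F_c + X_p(t_c))²`, `g = ½Σ_c (G_c + X_q(t_c))²` under `D1'^{⊗D}`,
`E[fg] − E[f]E[g] = (D/2)·C_D(p,q)² + (Σ_c F_cG_c)·C_D(p,q)`. [folklore] -/
theorem cov_quadObs_piD_eq (F G : Fin D → ℝ) (p q : Plaq 4) :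
    (∫ t : Fin D → EuclideanSpace ℝ (DirFree H), ((1 / 2 : ℝ) * ∑ c, (F c + dirCirc H p (t c)) ^ 2) *
          ((1 / 2 : ℝ) * ∑ c, (G c + dirCirc H q (t c)) ^ 2) ∂(Measure.pi fun _ : Fin D => boxDirichlet H)) -
        (∫ t : Fin D → EuclideanSpace ℝ (DirFree H), (1 / 2 : ℝ) * ∑ c, (F c + dirCirc H p (t c)) ^ 2
            ∂(Measure.pi fun _ : Fin D => boxDirichlet H)) *
          (∫ t : Fin D → EuclideanSpace ℝ (DirFree H), (1 / 2 : ℝ) * ∑ c, (G c + dirCirc H q (t c)) ^ 2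
            ∂(Measure.pi fun _ : Fin D => boxDirichlet H)) =
      (D : ℝ) / 2 * boxDirProjKernel H p q ^ 2 + (∑ c, F c * G c) * boxDirProjKernel H p q := by
  set PD := Measure.pi fun _ : Fin D => boxDirichlet H with hPD
  have hu : ∀ c : Fin D, MemLp (fun s => (F c + dirCirc H p s) ^ 2) 2 (boxDirichlet H) := by
    intro c
    have h4 : MemLp (fun s => F c + dirCirc H p s) 4 (boxDirichlet H) := (memLp_const (F c)).add (memLp_four_dirCirc p)
    have hi : Integrable (fun s => (F c + dirCirc H p s) ^ 4) (boxDirichlet H) := by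
      refine (h4.integrable_norm_pow (by norm_num)).congr (ae_of_all _ fun t => ?_)
      simp only [Real.norm_eq_abs]; exact (show Even 4 by decide).pow_abs _
    have h2 : Integrable (fun s => (F c + dirCirc H p s) ^ 2) (boxDirichlet H) :=
      ((memLp_const (F c)).add (memLp_two_dirCirc p)).integrable_sq
    rw [memLp_two_iff_integrable_sq h2.aestronglyMeasurable]
    exact hi.congr (ae_of_all _ fun t => by simp only; ring)
  have hw : ∀ c : Fin D, MemLp (fun s => (G c + dirCirc H q s) ^ 2) 2 (boxDirichlet H) := by
    intro c
    have h4 : MemLp (fun s => G c + dirCirc H q s) 4 (boxDirichlet H) := (memLp_const (G c)).add (memLp_four_dirCirc q)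
    have hi : Integrable (fun s => (G c + dirCirc H q s) ^ 4) (boxDirichlet H) := by
      refine (h4.integrable_norm_pow (by norm_num)).congr (ae_of_all _ fun t => ?_)
      simp only [Real.norm_eq_abs]; exact (show Even 4 by decide).pow_abs _
    have h2 : Integrable (fun s => (G c + dirCirc H q s) ^ 2) (boxDirichlet H) :=
      ((memLp_const (G c)).add (memLp_two_dirCirc q)).integrable_sq
    rw [memLp_two_iff_integrable_sq h2.aestronglyMeasurable]
    exact hi.congr (ae_of_all _ fun t => by simp only; ring)
  have hcov := cov_sum_pi_eq_sum_cov (boxDirichlet H) (fun c s => (F c + dirCirc H p s) ^ 2) (fun c s => (G c + dirCirc H q s) ^ 2) hu hw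
  simp only at hcov
  -- pull the factors `½` out
  have hiF : Integrable (fun t : Fin D → EuclideanSpace ℝ (DirFree H) => ∑ c, (F c + dirCirc H p (t c)) ^ 2) PD :=
    integrable_finsetSum _ fun c _ => integrable_comp_eval_piD ((hu c).integrable one_le_two) c
  have hiG : Integrable (fun t : Fin D → EuclideanSpace ℝ (DirFree H) => ∑ c, (G c + dirCirc H q (t c)) ^ 2) PD :=
    integrable_finsetSum _ fun c _ => integrable_comp_eval_piD ((hw c).integrable one_le_two) c
  have e1 : ∫ t, ((1 / 2 : ℝ) * ∑ c, (F c + dirCirc H p (t c)) ^ 2) * ((1 / 2 : ℝ) * ∑ c, (G c + dirCirc H q (t c)) ^ 2) ∂PD =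
      1 / 4 * ∫ t, (∑ c, (F c + dirCirc H p (t c)) ^ 2) * (∑ c, (G c + dirCirc H q (t c)) ^ 2) ∂PD := by
    rw [← integral_const_mul]
    exact integral_congr_ae (ae_of_all _ fun t => by ring)
  rw [e1, integral_const_mul, integral_const_mul]
  have e2 : 1 / 4 * (∫ t, (∑ c, (F c + dirCirc H p (t c)) ^ 2) * (∑ c, (G c + dirCirc H q (t c)) ^ 2) ∂PD) -
      1 / 2 * (∫ t, ∑ c, (F c + dirCirc H p (t c)) ^ 2 ∂PD) * (1 / 2 * ∫ t, ∑ c, (G c + dirCirc H q (t c)) ^ 2 ∂PD) =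
      1 / 4 * ((∫ t, (∑ c, (F c + dirCirc H p (t c)) ^ 2) * (∑ c, (G c + dirCirc H q (t c)) ^ 2) ∂PD) -
        (∫ t, ∑ c, (F c + dirCirc H p (t c)) ^ 2 ∂PD) * (∫ t, ∑ c, (G c + dirCirc H q (t c)) ^ 2 ∂PD)) := by ring
  rw [e2, hPD, hcov]
  simp_rw [cov_const_add_sq]
  rw [Finset.sum_add_distrib, Finset.sum_const, Finset.card_univ, Fintype.card_fin, ← Finset.sum_mul]
  simp only [nsmul_eq_mul]
  have : ∑ c, 4 * F c * G c = 4 * ∑ c, F c * G c := by rw [Finset.mul_sum]; exact Finset.sum_congr rfl fun c _ => by ring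
  rw [this]
  ring

/-- **Datum form** (the shape of `KernelCovExpansion` / `FlatCovExpansion`): with one-colour data `ϑ_c`, means `μ_c = mean ϑ_c`, backgrounds
`F̄_c(r) = sCirc (glue ϑ_c μ_c) r` and observables `f_r(t) = ½Σ_c (sCirc (glue ϑ_c (μ_c + t_c)) r)²`:
`E_{D1'^{⊗D}}[f_p f_q] − E[f_p]E[f_q] = (D/2)·boxDirProjKernel H p q² + (Σ_c F̄_c(p)F̄_c(q))·boxDirProjKernel H p q`. [folklore] -/
theorem cov_quadObs_datum_eqD (ϑ : Fin D → (Literature.MathematicalPhysics.QuantumLattice.ZdEdge 4 → ℝ)) (p q : Plaq 4) :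
    (∫ t : Fin D → EuclideanSpace ℝ (DirFree H),
        ((1 / 2 : ℝ) * ∑ c, (sCirc (glue (pin := fun e => e ∉ dirFreeEdges H) dirCorner (2 * H + 3) (ϑ c)
            (mean (fun e => e ∉ dirFreeEdges H) dirCorner (2 * H + 3) (ϑ c) + WithLp.ofLp (t c))) p) ^ 2) *
          ((1 / 2 : ℝ) * ∑ c, (sCirc (glue (pin := fun e => e ∉ dirFreeEdges H) dirCorner (2 * H + 3) (ϑ c)
            (mean (fun e => e ∉ dirFreeEdges H) dirCorner (2 * H + 3) (ϑ c) + WithLp.ofLp (t c))) q) ^ 2)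
        ∂(Measure.pi fun _ : Fin D => boxDirichlet H)) -
      (∫ t : Fin D → EuclideanSpace ℝ (DirFree H),
          (1 / 2 : ℝ) * ∑ c, (sCirc (glue (pin := fun e => e ∉ dirFreeEdges H) dirCorner (2 * H + 3) (ϑ c)
            (mean (fun e => e ∉ dirFreeEdges H) dirCorner (2 * H + 3) (ϑ c) + WithLp.ofLp (t c))) p) ^ 2
          ∂(Measure.pi fun _ : Fin D => boxDirichlet H)) *
        (∫ t : Fin D → EuclideanSpace ℝ (DirFree H),
          (1 / 2 : ℝ) * ∑ c, (sCirc (glue (pin := fun e => e ∉ dirFreeEdges H) dirCorner (2 * H + 3) (ϑ c)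
            (mean (fun e => e ∉ dirFreeEdges H) dirCorner (2 * H + 3) (ϑ c) + WithLp.ofLp (t c))) q) ^ 2
          ∂(Measure.pi fun _ : Fin D => boxDirichlet H)) =
      (D : ℝ) / 2 * boxDirProjKernel H p q ^ 2 +
        (∑ c, (sCirc (glue (pin := fun e => e ∉ dirFreeEdges H) dirCorner (2 * H + 3) (ϑ c)
              (mean (fun e => e ∉ dirFreeEdges H) dirCorner (2 * H + 3) (ϑ c))) p) *
            (sCirc (glue (pin := fun e => e ∉ dirFreeEdges H) dirCorner (2 * H + 3) (ϑ c)
              (mean (fun e => e ∉ dirFreeEdges H) dirCorner (2 * H + 3) (ϑ c))) q)) *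
          boxDirProjKernel H p q := by
  simp_rw [sCirc_glue_add_ofLp]
  exact cov_quadObs_piD_eq _ _ p q

/-- **Flat form**, `D` colours (no datum, no background): `E[f_p f_q] − E[f_p]E[f_q] = (D/2)·boxDirProjKernel H p q²` for
`f_r(t) = ½Σ_c X_r(t_c)²`. [folklore] -/
theorem cov_quadObs_flat_eqD (p q : Plaq 4) :
    (∫ t : Fin D → EuclideanSpace ℝ (DirFree H), ((1 / 2 : ℝ) * ∑ c, dirCirc H p (t c) ^ 2) * ((1 / 2 : ℝ) * ∑ c, dirCirc H q (t c) ^ 2)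
          ∂(Measure.pi fun _ : Fin D => boxDirichlet H)) -
        (∫ t : Fin D → EuclideanSpace ℝ (DirFree H), (1 / 2 : ℝ) * ∑ c, dirCirc H p (t c) ^ 2 ∂(Measure.pi fun _ : Fin D => boxDirichlet H)) *
          (∫ t : Fin D → EuclideanSpace ℝ (DirFree H), (1 / 2 : ℝ) * ∑ c, dirCirc H q (t c) ^ 2 ∂(Measure.pi fun _ : Fin D => boxDirichlet H)) =
      (D : ℝ) / 2 * boxDirProjKernel H p q ^ 2 := by
  have h := cov_quadObs_piD_eq (H := H) (D := D) (fun _ => 0) (fun _ => 0) p q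
  simp only [zero_add, mul_zero, Finset.sum_const_zero, zero_mul, add_zero] at h
  exact h


end Summit.QuantumFields.YangMills.Theorems.ColdBoxAllGroups

end
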